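import Literature.Probability.Percolation.SiteCouplingGSide
import Literature.Probability.Percolation.SiteCoveringStrictMonotonicity
import Literature.Probability.Percolation.SiteBoundedDegreeCriticalProb
import Literature.Probability.Percolation.CoveringStrictMonotonicityHolds
import HarnessLib

/-!
# Strict monotonicity of `p_c^site` under quotients by free actions (Martineau–Severo 2019, Corollary 2.2 for
# site percolation): the discharge

Final file of the inline proof of `Literature.Probability.Percolation.MartineauSevero2019_cor22_site`
("`p_c^site(𝒢) < p_c^site(𝒢/Γ)` for a non-trivial group `Γ` acting freely by automorphisms with both graphs
quasi-transitive and `p_c^site(𝒢) < 1`"), following Martineau–Severo, Ann. Probab. 47 (2019), §4, read for site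
percolation (§2 Convention, §5 Remark 4, end of §6):

* Proposition 4.2 (`SiteEnhProp42.exists_lt_siteCriticalProb_enhSiteEvent_ge`): for every `s > 0` there is
  `p < p_c^site(ℋ)` with `inf_L ℙ_{p,s}(𝓔_L(ℋ)) > 0` (essential site enhancement, Aizenman–Grimmett);
* Proposition 4.1 (`SiteCoupling.siteEnhMeasure_enhSiteEvent_le_siteFarEvent`): `ℙ_{p,s}(𝓔_L(ℋ)) ≤ P^{site,𝒢}_p(Far_L)`
  for the block parameters `p = 1-(1-p̂)^N`, `s = p̂^N`, made uniform in `p ≥ ε` by the monotonicity of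
  `ℙ_{p,s}(𝓔_L)` in `s` and the `N`-th root parametrisation (`exists_orParam_section`, bond discharge file);
* the assembly `SiteOrbitQuotient.siteCriticalProb_lt_of_props` (`p_c^site(ℋ) > 0` by bounded degree,
  `siteCriticalProb_pos_of_degree_le`), with the tameness radius of `CoveringTameFibres.exists_tame_pos` (Lemma 7.2)
  feeding the vertex two-lift structure `SiteCoupling.SiteTwoLiftData` (Lemma 5.1, vertex form).

## References

* S. Martineau, F. Severo, *Strict monotonicity of percolation thresholds under covering maps*, Ann. Probab. 47
  (2019) 4116–4136, Corollary 2.2, §4 (Propositions 4.1, 4.2), §5 (with Remark 4), §6, §7 [MartineauSevero2019].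
-/

noncomputable section

namespace Literature.Probability.Percolation

open MeasureTheory Literature.Barriers.CriticalPhenomena StarCoins
open scoped Classical

/-- **Martineau–Severo 2019, Corollary 2.2 for site percolation** (`p_c^site(𝒢) < p_c^site(𝒢/Γ)`), discharged.
[cite: MartineauSevero2019, Corollary 2.2 (site reading: §2 Convention, §5 Remark 4); proof: §4 (Propositions 4.1, 4.2), §5, §6, §7] -/
theorem MartineauSevero2019_cor22_site_holds : MartineauSevero2019_cor22_site := by
  intro V _ G _ Γ _ _ hnt hact hfree hG hqG hqH x hpc
  haveI : Nontrivial Γ := hnt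
  have hact' : IsActionByAut G Γ := hact
  letI : (orbitQuotientGraph G Γ).LocallyFinite := quotLocallyFinite hact'
  haveI : Countable (MulAction.orbitRel.Quotient Γ V) :=
    inferInstanceAs (Countable (Quotient (MulAction.orbitRel Γ V)))
  have hH : (orbitQuotientGraph G Γ).Connected := quot_connected hG
  -- bounded degree, `p_c^site(ℋ) > 0`
  obtain ⟨D₀, hD₀⟩ := hqG.exists_degree_le
  have hD : ∀ u, (orbitQuotientGraph G Γ).degree u ≤ D₀ := quot_degree_le_of_degree_le hact' hD₀
  have hpcH : 0 < siteCriticalProb (orbitQuotientGraph G Γ) (qmk Γ x) :=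
    siteCriticalProb_pos_of_degree_le _ hD _
  -- tame fibres (Lemma 7.2) and the vertex two-lift structure (Lemma 5.1)
  obtain ⟨R, -, hR⟩ := exists_tame_pos hact' hfree hG hqG hqH
  have hR' : ∀ y, ∃ g : Γ, g • y ≠ y ∧ g • y ∈ graphBall G y R := fun y => by
    obtain ⟨g, hg, hgy⟩ := hR y
    exact ⟨g, fun h => hg (hfree g y h), hgy⟩
  obtain ⟨S⟩ := SiteCoupling.nonempty_siteTwoLiftData (r := R) hG hact' hfree (Nat.le_mul_of_pos_left R two_pos) hR'
  -- the number of copies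
  obtain ⟨N₀, hN₀u, hN₀d⟩ : ∃ N₀ : ℕ,
      (∀ u, (4 * R + 3) * ballVolume (orbitQuotientGraph G Γ) u (R + 1) +
        2 * ballVolume (orbitQuotientGraph G Γ) u (R + 1) ≤ N₀) ∧
      ∀ t : V, (SiteCoupling.dom Γ G R t).card ≤ N₀ := by
    refine ⟨(4 * R + 3) * (D₀ + 1) ^ (R + 1) + 2 * (D₀ + 1) ^ (R + 1) + (D₀ + 1) ^ (R + 1),
      fun u => ?_, fun t => ?_⟩
    · have hb : ballVolume (orbitQuotientGraph G Γ) u (R + 1) ≤ (D₀ + 1) ^ (R + 1) :=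
        ballVolume_le_pow_of_degree_le _ hD u (R + 1)
      have h1 : (4 * R + 3) * ballVolume (orbitQuotientGraph G Γ) u (R + 1) ≤ (4 * R + 3) * (D₀ + 1) ^ (R + 1) :=
        Nat.mul_le_mul_left _ hb
      have h2 : 2 * ballVolume (orbitQuotientGraph G Γ) u (R + 1) ≤ 2 * (D₀ + 1) ^ (R + 1) :=
        Nat.mul_le_mul_left _ hb
      omega
    · have h2 := EnhProp42.card_ballFin_le_pow hD (qmk Γ t) (R + 1)
      unfold SiteCoupling.dom
      omega
  -- work with `N = N₀ + 1 ≥ 1` copies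
  have hNu : ∀ u, (4 * R + 3) * ballVolume (orbitQuotientGraph G Γ) u (R + 1) +
      2 * ballVolume (orbitQuotientGraph G Γ) u (R + 1) ≤ N₀ + 1 := fun u => (hN₀u u).trans (Nat.le_succ _)
  have hNd : ∀ t : V, (SiteCoupling.dom Γ G R t).card ≤ N₀ + 1 := fun t => (hN₀d t).trans (Nat.le_succ _)
  obtain ⟨root, hroot, hmono, hpos⟩ := exists_orParam_section (N := N₀ + 1) (Nat.succ_ne_zero _)
  -- the assembly
  refine SiteOrbitQuotient.siteCriticalProb_lt_of_props G (orbitQuotientGraph G Γ) (qmk Γ) x (qmk Γ x)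
    (fun p s L => (SiteEnhProp42.siteEnhMeasure (MulAction.orbitRel.Quotient Γ V) p s).real
      (enhSiteEvent (orbitQuotientGraph G Γ) R (qmk Γ x) L)) (R + 1) hpc hpcH ?_ ?_
  · -- Proposition 4.1, uniformly in `p ≥ ε`, with `s = p̂(ε)^N`
    intro ε hε0
    let e : unitInterval := ⟨min ε 1, le_min hε0.le zero_le_one, min_le_right _ _⟩
    have he0 : 0 < (e : ℝ) := lt_min hε0 one_pos
    refine ⟨andParam (root e) (N₀ + 1), ?_, fun p hεp L _ => ?_⟩
    · rw [coe_andParam]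
      exact pow_pos (hpos e he0) _
    · have hep : e ≤ p := show min ε 1 ≤ (p : ℝ) from (min_le_left ε 1).trans hεp
      have h1 : (SiteEnhProp42.siteEnhMeasure (MulAction.orbitRel.Quotient Γ V) p (andParam (root e) (N₀ + 1))).real
            (enhSiteEvent (orbitQuotientGraph G Γ) R (qmk Γ x) L) ≤
          (SiteEnhProp42.siteEnhMeasure (MulAction.orbitRel.Quotient Γ V) p (andParam (root p) (N₀ + 1))).real
            (enhSiteEvent (orbitQuotientGraph G Γ) R (qmk Γ x) L) := by
        rw [← SiteEnhProp42.theta_eq_siteEnhMeasure_real hH R (qmk Γ x) L p _,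
          ← SiteEnhProp42.theta_eq_siteEnhMeasure_real hH R (qmk Γ x) L p _]
        refine AGLine.theta_mono_s (isUpperSet_enhSiteEvent _ R (qmk Γ x) L) p.2.1 p.2.2
          (andParam (root e) (N₀ + 1)).2.1 ?_ (andParam (root p) (N₀ + 1)).2.2
        rw [coe_andParam, coe_andParam]
        exact pow_le_pow_left₀ (root e).2.1 (hmono hep) _
      have h2 := SiteCoupling.siteEnhMeasure_enhSiteEvent_le_siteFarEvent hG hact' S x L (N₀ + 1) hNu hNd (root p)
      rw [hroot p] at h2
      exact h1.trans h2
  · -- Proposition 4.2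
    intro hpc1 ε hε0 hε s hs
    exact SiteEnhProp42.exists_lt_siteCriticalProb_enhSiteEvent_ge hH hD (qmk Γ x) R hpc1 hε0 hε s hs

end Literature.Probability.Percolation
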